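import Summits.QuantumFields.BalabanUV.Beta.EriceFlowEnclosureB12AsPrintedHistoryNonunique
import Literature.MathematicalPhysics.QuantumFieldTheory.Balaban1983to89.T4BetaFlowWellPosed

/-!
# Beta / EriceFlowEnclosureB12AsPrintedHistoryNonuniqueRuns — the TWO RUNS of the bump family: a free run A and a run B starting Δ higher
# in 1∕g², both solving (0.20) for the SAME history-dependent β, SAME depth 2n, DIFFERENT bare couplings, SAME renormalized coupling
# (β-flow team, prover 1 = recursion ∕ upper ∕ bare-coupling ∕ UNIQUENESS side, unit `b2b-balaban-beta-bflow-p1`, gen 34; ROW AP-I·C × ROW U;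
# PART 1 of the witness = `…HistoryNonunique` (§17–§18: the family and its letters); this file = §19; `…HistoryNonuniqueEnd` = the headlines)

HONEST FRAMING (page 1 of everything the β sub-cell writes): discharging `BetaPertH` makes Bałaban's UV stability UNCONDITIONAL — a
real constructive-QFT result; it is NOT the continuum limit and NOT the Clay problem.  HONEST DEPENDENCY (cell reorg 2026-08-19,
verbatim): «continuum YM on T⁴ ⇐ BetaPertH ∧ nine spine estimates (0/9 proved); BetaPertH ⇐ (D1) ∧ (D4) ∧ CAP+tail; G-an2-4 gates
asym, D1 and NE2/3/4.»  THIS MODULE DISCHARGES NOTHING: [folklore] arithmetic of ONE TOY FAMILY OF OURS (defining hypotheses, no `def`):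
  β_{j+1}(p₀, …, p_j) := b + 𝟙[n ≤ j < 2n]·ε·max(1 − |Σ_{i<n} (p_i − gᴮ_i)|∕M, 0)·χ(p_j),
  run A: gᴬ_i := (x₀ − b·i)^{−1∕2} (free, β ≡ b along it);  run B: gᴮ_i := (x₀ − b·i + ε·(n − (i − n)₊)₊)^{−1∕2} (β = b + ε along its band),
  M := Σ_{i<n}(gᴬ_i − gᴮ_i),  Δ = ε·n.
(0.20) of [I] = T. Bałaban, Commun. Math. Phys. **109** (1987) [Balaban1987RG1], p. 256, *"1∕g_k² = 1∕g²_{k+1} + β_{k+1}(g_k)"* with p. 298's history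
dependence, is the tree's `FlowStep.RGEqH`; nothing of Bałaban's β is asserted and no toy is claimed to resemble the construction.

WHAT THIS FILE PROVES (0 sorry, 0 def):
§19 `xA_pos` ∕ `xB_pos`, `inv_sq_gA` ∕ `inv_sq_gB` (via node U2's `T4BetaFlowWellPosed.one_div_sq_one_div_sqrt`), `gA_pos` ∕ `gB_pos`, `gB_le_gA`, `gA_le_end`, `runs_box` (both runs in
    ]0, gᴬ_{2n}]), **`runs_end_eq`** (gᴬ_{2n} = gᴮ_{2n}), **`runs_start_lt`** (gᴮ_0 < gᴬ_0), **`rgEqH_runA`**, **`rgEqH_runB`** (both solve (0.20) for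
    the family — for B provided χ(gᴮ_j) = 1 on the band), `M_pos`, **`M_ge`** (n·Δ∕(2(x₀ + Δ)^{3∕2}) ≤ M), `twoThirds_runB` (the small-box
    smallness for `BetaPertH`).
NOT CLAIMED: anything about Bałaban's β; Theorem 2; `BetaPertH`; continuum; Clay.
-/

namespace Summit.QuantumFields.BalabanUV.Beta.EriceFlowEnclosureB12AsPrintedHistoryNonuniqueRuns

open Finset
open Literature.MathematicalPhysics.QuantumFieldTheory.Balaban1983to89
open Literature.MathematicalPhysics.QuantumFieldTheory.Balaban1983to89.FlowStep (HBeta prefixOf Box mem_box RGEqH)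
open Summit.QuantumFields.BalabanUV.Beta.EriceFlowEnclosureB12AsPrintedHistoryNonunique (truncSum_eq inv_sqrt_sub_ge
  inv_sqrt_ge_two_thirds)

noncomputable section

/-! ## §19 The two runs -/

/-- Run A's inverse squares are positive up to the depth: 0 < x₀ − b·i for i ≤ 2n (b ≥ 0, 2bn < x₀). [folklore] -/
theorem xA_pos {x₀ b : ℝ} {n : ℕ} (hb : 0 ≤ b) (hx : b * (2 * n) < x₀) {i : ℕ} (hi : i ≤ 2 * n) : 0 < x₀ - b * i := by
  have : b * (i : ℝ) ≤ b * (2 * n) := mul_le_mul_of_nonneg_left (by exact_mod_cast hi) hb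
  linarith

/-- Run B's inverse squares are positive up to the depth (ε ≥ 0). [folklore] -/
theorem xB_pos {x₀ b ε : ℝ} {n : ℕ} (hb : 0 ≤ b) (hε : 0 ≤ ε) (hx : b * (2 * n) < x₀) {i : ℕ} (hi : i ≤ 2 * n) :
    0 < x₀ - b * i + ε * ((n - (i - n) : ℕ) : ℝ) := by
  have := xA_pos hb hx hi
  have : 0 ≤ ε * ((n - (i - n) : ℕ) : ℝ) := mul_nonneg hε (Nat.cast_nonneg _)
  linarith

/-- Run A: 1∕(gᴬ_i)² = x₀ − b·i. [folklore] -/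
theorem inv_sq_gA {gA : ℕ → ℝ} {x₀ b : ℝ} {n : ℕ} (hA : ∀ i, gA i = 1 / Real.sqrt (x₀ - b * i))
    (hb : 0 ≤ b) (hx : b * (2 * n) < x₀) {i : ℕ} (hi : i ≤ 2 * n) : 1 / (gA i) ^ 2 = x₀ - b * i := by
  rw [hA i]; exact T4BetaFlowWellPosed.one_div_sq_one_div_sqrt (xA_pos hb hx hi)

/-- Run B: 1∕(gᴮ_i)² = x₀ − b·i + ε·(n − (i − n)₊)₊. [folklore] -/
theorem inv_sq_gB {gB : ℕ → ℝ} {x₀ b ε : ℝ} {n : ℕ} (hB : ∀ i, gB i = 1 / Real.sqrt (x₀ - b * i + ε * ((n - (i - n) : ℕ) : ℝ)))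
    (hb : 0 ≤ b) (hε : 0 ≤ ε) (hx : b * (2 * n) < x₀) {i : ℕ} (hi : i ≤ 2 * n) :
    1 / (gB i) ^ 2 = x₀ - b * i + ε * ((n - (i - n) : ℕ) : ℝ) := by
  rw [hB i]; exact T4BetaFlowWellPosed.one_div_sq_one_div_sqrt (xB_pos hb hε hx hi)

/-- Run A's couplings are positive. [folklore] -/
theorem gA_pos {gA : ℕ → ℝ} {x₀ b : ℝ} {n : ℕ} (hA : ∀ i, gA i = 1 / Real.sqrt (x₀ - b * i))
    (hb : 0 ≤ b) (hx : b * (2 * n) < x₀) {i : ℕ} (hi : i ≤ 2 * n) : 0 < gA i := by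
  rw [hA i]; exact one_div_pos.mpr (Real.sqrt_pos.mpr (xA_pos hb hx hi))

/-- Run B's couplings are positive. [folklore] -/
theorem gB_pos {gB : ℕ → ℝ} {x₀ b ε : ℝ} {n : ℕ} (hB : ∀ i, gB i = 1 / Real.sqrt (x₀ - b * i + ε * ((n - (i - n) : ℕ) : ℝ)))
    (hb : 0 ≤ b) (hε : 0 ≤ ε) (hx : b * (2 * n) < x₀) {i : ℕ} (hi : i ≤ 2 * n) : 0 < gB i := by
  rw [hB i]; exact one_div_pos.mpr (Real.sqrt_pos.mpr (xB_pos hb hε hx hi))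

/-- Run B lies below run A: gᴮ_i ≤ gᴬ_i (its inverse square is larger by ε·(…) ≥ 0). [folklore] -/
theorem gB_le_gA {gA gB : ℕ → ℝ} {x₀ b ε : ℝ} {n : ℕ} (hA : ∀ i, gA i = 1 / Real.sqrt (x₀ - b * i))
    (hB : ∀ i, gB i = 1 / Real.sqrt (x₀ - b * i + ε * ((n - (i - n) : ℕ) : ℝ)))
    (hb : 0 ≤ b) (hε : 0 ≤ ε) (hx : b * (2 * n) < x₀) {i : ℕ} (hi : i ≤ 2 * n) : gB i ≤ gA i := by
  rw [hA i, hB i]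
  have h0 := xA_pos hb hx hi
  have : 0 ≤ ε * ((n - (i - n) : ℕ) : ℝ) := mul_nonneg hε (Nat.cast_nonneg _)
  exact one_div_le_one_div_of_le (Real.sqrt_pos.mpr h0) (Real.sqrt_le_sqrt (by linarith))

/-- Run A is increasing toward the infrared end: gᴬ_i ≤ gᴬ_{2n} for i ≤ 2n (b ≥ 0). [folklore] -/
theorem gA_le_end {gA : ℕ → ℝ} {x₀ b : ℝ} {n : ℕ} (hA : ∀ i, gA i = 1 / Real.sqrt (x₀ - b * i))
    (hb : 0 ≤ b) (hx : b * (2 * n) < x₀) {i : ℕ} (hi : i ≤ 2 * n) : gA i ≤ gA (2 * n) := by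
  rw [hA i, hA (2 * n)]
  have h0 := xA_pos hb hx (le_refl (2 * n))
  have : b * (i : ℝ) ≤ b * (2 * n) := mul_le_mul_of_nonneg_left (by exact_mod_cast hi) hb
  push_cast at h0 ⊢
  exact one_div_le_one_div_of_le (Real.sqrt_pos.mpr h0) (Real.sqrt_le_sqrt (by linarith))

/-- Both runs stay in the box ]0, gᴬ_{2n}] up to the depth. [folklore] -/
theorem runs_box {gA gB : ℕ → ℝ} {x₀ b ε : ℝ} {n : ℕ} (hA : ∀ i, gA i = 1 / Real.sqrt (x₀ - b * i))
    (hB : ∀ i, gB i = 1 / Real.sqrt (x₀ - b * i + ε * ((n - (i - n) : ℕ) : ℝ)))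
    (hb : 0 ≤ b) (hε : 0 ≤ ε) (hx : b * (2 * n) < x₀) :
    (∀ i, i ≤ 2 * n → 0 < gA i ∧ gA i ≤ gA (2 * n)) ∧ (∀ i, i ≤ 2 * n → 0 < gB i ∧ gB i ≤ gA (2 * n)) :=
  ⟨fun _ hi => ⟨gA_pos hA hb hx hi, gA_le_end hA hb hx hi⟩,
    fun _ hi => ⟨gB_pos hB hb hε hx hi, (gB_le_gA hA hB hb hε hx hi).trans (gA_le_end hA hb hx hi)⟩⟩

/-- **THE TWO RUNS END AT THE SAME RENORMALIZED COUPLING**: gᴬ_{2n} = gᴮ_{2n} (the extra term is ε·(n − n) = 0). [folklore] -/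
theorem runs_end_eq {gA gB : ℕ → ℝ} {x₀ b ε : ℝ} {n : ℕ} (hA : ∀ i, gA i = 1 / Real.sqrt (x₀ - b * i))
    (hB : ∀ i, gB i = 1 / Real.sqrt (x₀ - b * i + ε * ((n - (i - n) : ℕ) : ℝ))) : gA (2 * n) = gB (2 * n) := by
  rw [hA, hB, show n - (2 * n - n) = 0 by omega]
  simp

/-- **… AND START AT DIFFERENT BARE COUPLINGS**: gᴮ_0 < gᴬ_0 (ε > 0, n ≥ 1). [folklore] -/
theorem runs_start_lt {gA gB : ℕ → ℝ} {x₀ b ε : ℝ} {n : ℕ} (hA : ∀ i, gA i = 1 / Real.sqrt (x₀ - b * i))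
    (hB : ∀ i, gB i = 1 / Real.sqrt (x₀ - b * i + ε * ((n - (i - n) : ℕ) : ℝ)))
    (hb : 0 ≤ b) (hε : 0 < ε) (hx : b * (2 * n) < x₀) (hn : 1 ≤ n) : gB 0 < gA 0 := by
  rw [hA 0, hB 0]
  have h0 := xA_pos hb hx (Nat.zero_le (2 * n))
  have hpos : 0 < ε * ((n - (0 - n) : ℕ) : ℝ) := by
    rw [show n - (0 - n) = n by omega]
    exact mul_pos hε (by exact_mod_cast hn)
  exact one_div_lt_one_div_of_lt (Real.sqrt_pos.mpr h0) (Real.sqrt_lt_sqrt h0.le (by linarith))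

/-- **RUN A SOLVES (0.20)** for the family (M = Σ_{i<n}(gᴬ_i − gᴮ_i) > 0): along A the bump reads max(1 − |M|∕M, 0) = 0, so β ≡ b, and
1∕(gᴬ_j)² − 1∕(gᴬ_{j+1})² = b. [cite: Balaban1987RG1, (0.20) p.256 with p.298] -/
theorem rgEqH_runA {β : HBeta} {b ε M x₀ : ℝ} {n : ℕ} {gA gB : ℕ → ℝ} {χ : ℝ → ℝ}
    (hβ : ∀ (j : ℕ) (p : Fin (j + 1) → ℝ), β j p = b + (if n ≤ j ∧ j < 2 * n then
      ε * max (1 - |∑ i : Fin (j + 1), (if (i : ℕ) < n then p i - gB i else 0)| / M) 0 * χ (p (Fin.last j)) else 0))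
    (hA : ∀ i, gA i = 1 / Real.sqrt (x₀ - b * i)) (hb : 0 ≤ b) (hx : b * (2 * n) < x₀)
    (hM : M = ∑ i ∈ range n, (gA i - gB i)) (hMpos : 0 < M) : RGEqH (2 * n) β gA := by
  intro j hj
  rw [inv_sq_gA hA hb hx hj.le, inv_sq_gA hA hb hx (Nat.succ_le_of_lt hj), hβ j (prefixOf gA j)]
  have hzero : (if n ≤ j ∧ j < 2 * n then
      ε * max (1 - |∑ i : Fin (j + 1), (if (i : ℕ) < n then prefixOf gA j i - gB i else 0)| / M) 0 *
        χ (prefixOf gA j (Fin.last j)) else 0) = 0 := by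
    split_ifs with hband
    · have hs : ∑ i : Fin (j + 1), (if (i : ℕ) < n then prefixOf gA j i - gB i else 0) = M := by
        simp only [FlowStep.prefixOf_apply]
        rw [truncSum_eq (fun i => gA i - gB i) (by omega), hM]
      rw [hs, abs_of_pos hMpos, div_self hMpos.ne', sub_self, max_self, mul_zero, zero_mul]
    · rfl
  rw [hzero]
  push_cast
  ring

/-- **RUN B SOLVES (0.20)** for the family, provided χ = 1 at run B's band couplings: along B the bump reads max(1 − 0, 0)·χ(gᴮ_j) = 1 on the
band, so β = b + ε there (and b off the band) — exactly run B's decrements. [cite: Balaban1987RG1, (0.20) p.256 with p.298] -/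
theorem rgEqH_runB {β : HBeta} {b ε M x₀ : ℝ} {n : ℕ} {gB : ℕ → ℝ} {χ : ℝ → ℝ}
    (hβ : ∀ (j : ℕ) (p : Fin (j + 1) → ℝ), β j p = b + (if n ≤ j ∧ j < 2 * n then
      ε * max (1 - |∑ i : Fin (j + 1), (if (i : ℕ) < n then p i - gB i else 0)| / M) 0 * χ (p (Fin.last j)) else 0))
    (hB : ∀ i, gB i = 1 / Real.sqrt (x₀ - b * i + ε * ((n - (i - n) : ℕ) : ℝ)))
    (hb : 0 ≤ b) (hε : 0 ≤ ε) (hx : b * (2 * n) < x₀) (hχB : ∀ j, n ≤ j → j < 2 * n → χ (gB j) = 1) :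
    RGEqH (2 * n) β gB := by
  intro j hj
  rw [inv_sq_gB hB hb hε hx hj.le, inv_sq_gB hB hb hε hx (Nat.succ_le_of_lt hj), hβ j (prefixOf gB j)]
  by_cases hband : n ≤ j ∧ j < 2 * n
  · rw [if_pos hband]
    have hs : ∑ i : Fin (j + 1), (if (i : ℕ) < n then prefixOf gB j i - gB i else 0) = 0 :=
      Finset.sum_eq_zero fun i _ => by simp
    rw [hs, abs_zero, zero_div, sub_zero, max_eq_left zero_le_one, mul_one, FlowStep.prefixOf_apply, Fin.val_last,
      hχB j hband.1 hband.2, mul_one]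
    have hnat : n - (j - n) = (n - (j + 1 - n)) + 1 := by omega
    rw [hnat]
    push_cast
    ring
  · rw [if_neg hband, add_zero]
    have hjn : j < n := by omega
    have hnat : n - (j - n) = n - (j + 1 - n) := by omega
    rw [hnat]
    push_cast
    ring

/-- M > 0: every term gᴬ_i − gᴮ_i, i < n, is positive when ε > 0 (run B sits ε·n higher in 1∕g² there) and n ≥ 1. [folklore] -/
theorem M_pos {gA gB : ℕ → ℝ} {x₀ b ε : ℝ} {n : ℕ} (hA : ∀ i, gA i = 1 / Real.sqrt (x₀ - b * i))
    (hB : ∀ i, gB i = 1 / Real.sqrt (x₀ - b * i + ε * ((n - (i - n) : ℕ) : ℝ)))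
    (hb : 0 ≤ b) (hε : 0 < ε) (hx : b * (2 * n) < x₀) (hn : 1 ≤ n) : 0 < ∑ i ∈ range n, (gA i - gB i) := by
  refine Finset.sum_pos (fun i hi => ?_) ⟨0, mem_range.mpr hn⟩
  have hi2 : i ≤ 2 * n := by have := mem_range.mp hi; omega
  rw [hA i, hB i, show n - (i - n) = n by have := mem_range.mp hi; omega]
  have h0 := xA_pos hb hx hi2
  have hpos : 0 < ε * (n : ℝ) := mul_pos hε (by exact_mod_cast hn)
  exact sub_pos.mpr (one_div_lt_one_div_of_lt (Real.sqrt_pos.mpr h0) (Real.sqrt_lt_sqrt h0.le (by linarith)))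

/-- **THE SIZE OF M**: with Δ := ε·n, `n·Δ∕(2(x₀ + Δ)√(x₀ + Δ)) ≤ M = Σ_{i<n}(gᴬ_i − gᴮ_i)` — each term is ≥ Δ∕(2(x + Δ)√(x + Δ)) at x = x₀ − b·i ≤ x₀
(`inv_sqrt_sub_ge`), and that lower bound decreases in x. [folklore] -/
theorem M_ge {gA gB : ℕ → ℝ} {x₀ b ε : ℝ} {n : ℕ} (hA : ∀ i, gA i = 1 / Real.sqrt (x₀ - b * i))
    (hB : ∀ i, gB i = 1 / Real.sqrt (x₀ - b * i + ε * ((n - (i - n) : ℕ) : ℝ)))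
    (hb : 0 ≤ b) (hε : 0 ≤ ε) (hx : b * (2 * n) < x₀) :
    (n : ℝ) * (ε * n / (2 * (x₀ + ε * n) * Real.sqrt (x₀ + ε * n))) ≤ ∑ i ∈ range n, (gA i - gB i) := by
  have hcard : (n : ℝ) * (ε * n / (2 * (x₀ + ε * n) * Real.sqrt (x₀ + ε * n)))
      = ∑ i ∈ range n, ε * n / (2 * (x₀ + ε * n) * Real.sqrt (x₀ + ε * n)) := by
    rw [Finset.sum_const, card_range, nsmul_eq_mul]
  rw [hcard]
  refine Finset.sum_le_sum fun i hi => ?_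
  have hi2 : i ≤ 2 * n := by have := mem_range.mp hi; omega
  have hxi := xA_pos hb hx hi2
  have hΔ : 0 ≤ ε * n := mul_nonneg hε (Nat.cast_nonneg n)
  rw [hA i, hB i, show n - (i - n) = n by have := mem_range.mp hi; omega]
  refine le_trans ?_ (inv_sqrt_sub_ge hxi hΔ)
  -- the lower bound is antitone in x: x₀ − b·i ≤ x₀
  have hle : x₀ - b * i + ε * n ≤ x₀ + ε * n := by
    have : 0 ≤ b * (i : ℝ) := mul_nonneg hb (Nat.cast_nonneg i); linarith
  have hpos : 0 < x₀ - b * i + ε * n := by linarith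
  have hs : Real.sqrt (x₀ - b * i + ε * n) ≤ Real.sqrt (x₀ + ε * n) := Real.sqrt_le_sqrt hle
  have hs0 : 0 < Real.sqrt (x₀ - b * i + ε * n) := Real.sqrt_pos.mpr hpos
  exact div_le_div_of_nonneg_left hΔ (by positivity) (by nlinarith [mul_le_mul hle hs hs0.le (by linarith)])

/-- Run B's couplings at the n oldest scales are at least two thirds of run A's when Δ = ε·n ≤ (5∕4)·(x₀ − b·(2n)) (≤ (5∕4)·(x₀ − b·i)):
whence Σ_{i<n}(2gᴮ_i − gᴬ_i) ≥ Σ_{i<n} gᴬ_i∕3 ≥ n·gᴬ_0∕3 — the smallness feeding `bump_zero_of_smallBox` for γ′ ≤ gᴬ_0∕3. [folklore] -/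
theorem twoThirds_runB {gA gB : ℕ → ℝ} {x₀ b ε : ℝ} {n : ℕ} (hA : ∀ i, gA i = 1 / Real.sqrt (x₀ - b * i))
    (hB : ∀ i, gB i = 1 / Real.sqrt (x₀ - b * i + ε * ((n - (i - n) : ℕ) : ℝ)))
    (hb : 0 ≤ b) (hε : 0 ≤ ε) (hx : b * (2 * n) < x₀) (hΔ : ε * n ≤ 5 / 4 * (x₀ - b * (2 * n))) {γ' : ℝ}
    (hγ' : γ' ≤ gA 0 / 3) : (n : ℝ) * γ' ≤ ∑ i ∈ range n, (2 * gB i - gA i) := by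
  have hcard : (n : ℝ) * γ' = ∑ i ∈ range n, γ' := by rw [Finset.sum_const, card_range, nsmul_eq_mul]
  rw [hcard]
  refine Finset.sum_le_sum fun i hi => ?_
  have hi2 : i ≤ 2 * n := by have := mem_range.mp hi; omega
  have hxi := xA_pos hb hx hi2
  have hΔi : ε * n ≤ 5 / 4 * (x₀ - b * i) := by
    have : b * (i : ℝ) ≤ b * (2 * n) := mul_le_mul_of_nonneg_left (by exact_mod_cast hi2) hb
    linarith
  have h23 : 2 / 3 * gA i ≤ gB i := by
    rw [hA i, hB i, show n - (i - n) = n by have := mem_range.mp hi; omega]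
    exact inv_sqrt_ge_two_thirds hxi (mul_nonneg hε (Nat.cast_nonneg n)) hΔi
  -- gᴬ_0 ≤ gᴬ_i
  have h0i : gA 0 ≤ gA i := by
    rw [hA 0, hA i]
    have : 0 ≤ b * (i : ℝ) := mul_nonneg hb (Nat.cast_nonneg i)
    push_cast
    exact one_div_le_one_div_of_le (Real.sqrt_pos.mpr hxi) (Real.sqrt_le_sqrt (by linarith))
  linarith

end

end Summit.QuantumFields.BalabanUV.Beta.EriceFlowEnclosureB12AsPrintedHistoryNonuniqueRuns
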